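import Summits.QuantumFields.YangMills.Theorems.BalabanUVNodesN08AlphaProfileBuild
import Summits.QuantumFields.YangMills.Theorems.BalabanUVNodesN08AlphaB7Scale1

/-!
# Route «BalabanUVNodes», Track-A DAG node N08 = [Balaban1985UV3] — (α) clause, the in-edge sentence (b11‴) CONSTRUCTED, part 5c:
# THE PROFILE OF A HISTORY LIES IN [7]'S CLOSED REGULAR CLASS `regClassC`

Cell `pub-ymgap`, seat `pub-ymgap-dag-n08-d` gen 5, file F5c (over F5b `…ProfileBuild`).  `bears_on: R4∕N08`; filed `--supports stmt-QuantumFields-19910 --as helper`.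
Sorry-free, standard axioms.

THE REGULARITY (★ `prof_mem_regClassC`, collars `Rcol j ≥ 14` for `j + 1 ≤ k`, `k ≤ K`): at a torus plaquette `(y; μ,ν)` with a corner in `Ω_j(h)` let `j⋆ ≥ j` be
the largest such scale; within fine distance `2` of its corners only the cut-off weights `ω_{j⋆} = 1 − θ_{j⋆+1}`, `ω_{j⋆+1} = θ_{j⋆+1}` are alive (§1, from F4's
`Theta_eq_one_of_distTo_le_two` ∕ `Theta_succ_eq_zero_near_bad` ∕ `Theta_antitone`), so F5a's two-level bound with F3's `|curl patPot| ≤ amp`, `|patPot| ≤ amp·(M+1)`,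
the `1/(8L^{j⋆})`-Lipschitz cut-off and `amp (j+1) ≤ amp j / L` gives ★ `abs_curl_potZ_le`: `|curl potZ| ≤ 2·amp j⋆` (§2), and `2·amp j⋆·‖X‖ ≤ 2·amp j·‖X‖ =
½C68·g_jp(g_j)·L^{−2j}` is the closed class's budget.
HONEST FRAMING: kernel estimates for a CONSTRUCTED test configuration; nothing of [B10] ∕ [7] ∕ [4]'s estimates asserted; count-neutral; NOT a discharge of N08.
-/

noncomputable section

namespace Summit.QuantumFields.YangMills.Theorems.BalabanUVNodesN08AlphaProfileRegular

open scoped BigOperators Matrix.Norms.L2Operator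
open NormedSpace
open Literature.MathematicalPhysics.QuantumFieldTheory.Balaban1983to89
open Literature.MathematicalPhysics.QuantumFieldTheory.Balaban1983to89.B10 (pFun)
open Literature.MathematicalPhysics.QuantumFieldTheory.Balaban1985CMP102
open Literature.MathematicalPhysics.QuantumFieldTheory.Balaban1985CMP102.Setting
open Summit.QuantumFields.Balaban3D.Carriers
open Summit.QuantumFields.Balaban3D.Proofs.Primitives (AlphaConsts)
open Summit.QuantumFields.Balaban3D.Proofs.LiftBridge (liftCfg)
open Summit.QuantumFields.Balaban3D.Proofs.TorusLift (projSite projSite_add_e)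
open Summit.QuantumFields.Balaban3D.Proofs.Run3Collar (tdist_shift_le)
open Summit.QuantumFields.YangMills.Theorems.BalabanUVNodesN08AlphaRegSel (plaqVar)
open Summit.QuantumFields.YangMills.Theorems.BalabanUVNodesN08AlphaCompactSel (regClassC)
open Summit.QuantumFields.YangMills.Theorems.BalabanUVNodesN08AlphaAbelianLift
open Summit.QuantumFields.YangMills.Theorems.BalabanUVNodesN08AlphaAbelianAverage
open Summit.QuantumFields.YangMills.Theorems.BalabanUVNodesN08AlphaPattern
open Summit.QuantumFields.YangMills.Theorems.BalabanUVNodesN08AlphaHistGeom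
open Summit.QuantumFields.YangMills.Theorems.BalabanUVNodesN08AlphaBlend
open Summit.QuantumFields.YangMills.Theorems.BalabanUVNodesN08AlphaProfileBuild
open B3Taylor310LocalRemainder (tdist_comm tdist_triangle)
open B7Prop1Explicit (e e_apply)

variable {L : ℕ} (S : Scales L) {G : Type} [GaugeGroup G] [MeasurableSpace G] {𝔊 : GroupModel G} (𝔠 : AlphaConsts L 𝔊.N)

/-! ## §1 The weights near a plaquette: localisation to two scales -/

section Weights

variable (X : Matrix (Fin 𝔊.N) (Fin 𝔊.N) ℂ) {k : ℕ} (h : Hist S.P k)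

/-- The collar hypothesis of the construction: `Rcol j ≥ R0 + 6 = 14` on the recorded scales. [cite: Balaban1985UV3, (39) p.266] -/
def CollarOK (k : ℕ) : Prop := ∀ j, j + 1 ≤ k → R0 + 6 ≤ rcolOf S 𝔠.lane.carrier j

/-- The weights are non-negative. [folklore] -/
theorem wgt_nonneg (hk : k ≤ S.P.m + S.P.K) (hR : CollarOK S 𝔠 k) (j : ℕ) (y : Site S.P 0) : 0 ≤ wgt S 𝔠 h j y := by
  unfold wgt
  have := Theta_succ_le 𝔠.lane.carrier.M₁ (rcolOf S 𝔠.lane.carrier) R0 h rfl hk (by norm_num [R0]) hR j y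
  linarith

/-- The weights sum to at most `1` (telescoping to `θ_0 − θ_k ≤ 1`). [folklore] -/
theorem sum_wgt_le_one (j' : ℕ) (y : Site S.P 0) : ∑ j ∈ Finset.range j', wgt S 𝔠 h j y ≤ 1 := by
  unfold wgt
  rw [Finset.sum_range_sub']
  have h0 := (Theta_mem 𝔠.lane.carrier.M₁ (rcolOf S 𝔠.lane.carrier) R0 h 0 y).2
  have h1 := (Theta_mem 𝔠.lane.carrier.M₁ (rcolOf S 𝔠.lane.carrier) R0 h j' y).1
  linarith

/-- **LOCALISATION**: if a site `c ∈ Ω_{j⋆}(h)` (`j⋆ < k`) and NO site within fine distance `2` of `c`... precisely: for `y` with `tdist c y ≤ 2`, (i) `θ_j(y) = 1`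
for `j ≤ j⋆`; (ii) if moreover `y ∉ Ω_{j⋆+1}(h)` (or `k ≤ j⋆ + 1`), `θ_j(y) = 0` for `j ≥ j⋆ + 2`.  Hence only `ω_{j⋆}, ω_{j⋆+1}` can be non-zero at `y`,
with `ω_{j⋆}(y) = 1 − θ_{j⋆+1}(y)` and `ω_{j⋆+1}(y) = θ_{j⋆+1}(y)`. [folklore] -/
theorem Theta_eq_one_of_near (hk : k ≤ S.P.m + S.P.K) (hR : CollarOK S 𝔠 k) {js : ℕ} (hjs : js < k) {c : Site S.P 0}
    (hc : c ∈ Omega 𝔠.lane.carrier.M₁ (rcolOf S 𝔠.lane.carrier) k h js) {y : Site S.P 0} (hy : Site.tdist c y ≤ 2) {j : ℕ} (hj : j ≤ js) :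
    Theta 𝔠.lane.carrier.M₁ (rcolOf S 𝔠.lane.carrier) R0 h j y = 1 := by
  have hR1 : 1 ≤ R0 := by norm_num [R0]
  have h1 : Theta 𝔠.lane.carrier.M₁ (rcolOf S 𝔠.lane.carrier) R0 h js y = 1 :=
    Theta_eq_one_of_distTo_le_two _ _ R0 h hR1 hjs (Or.inr ⟨c, hc⟩) ((distTo_le hc).trans (by rw [tdist_comm]; exact hy))
  have hanti := Theta_antitone 𝔠.lane.carrier.M₁ (rcolOf S 𝔠.lane.carrier) R0 h rfl hk hR1 hR hj y
  have hle := (Theta_mem 𝔠.lane.carrier.M₁ (rcolOf S 𝔠.lane.carrier) R0 h j y).2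
  linarith

/-- (ii) of the localisation. [folklore] -/
theorem Theta_eq_zero_of_near (hk : k ≤ S.P.m + S.P.K) (hR : CollarOK S 𝔠 k) {js : ℕ} {y : Site S.P 0}
    (hy : k ≤ js + 1 ∨ y ∉ Omega 𝔠.lane.carrier.M₁ (rcolOf S 𝔠.lane.carrier) k h (js + 1)) {j : ℕ} (hj : js + 2 ≤ j) :
    Theta 𝔠.lane.carrier.M₁ (rcolOf S 𝔠.lane.carrier) R0 h j y = 0 := by
  have hR1 : 1 ≤ R0 := by norm_num [R0]
  have h2 : Theta 𝔠.lane.carrier.M₁ (rcolOf S 𝔠.lane.carrier) R0 h (js + 2) y = 0 := by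
    rcases hy with hk' | hy'
    · exact Theta_of_le _ _ R0 h (by omega) y
    · by_cases hk2 : js + 2 ≤ k
      · exact Theta_succ_eq_zero_near_bad _ _ R0 h rfl hk (show js + 1 + 1 ≤ k by omega) hR1 (hR (js + 1) (by omega)) (Or.inr hy')
          (by rw [tdist_self']; omega)
      · exact Theta_of_le _ _ R0 h (by omega) y
  have hanti := Theta_antitone 𝔠.lane.carrier.M₁ (rcolOf S 𝔠.lane.carrier) R0 h rfl hk hR1 hR hj y
  have hge := (Theta_mem 𝔠.lane.carrier.M₁ (rcolOf S 𝔠.lane.carrier) R0 h j y).1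
  linarith

/-- **Only the weights `j⋆, j⋆+1` survive near such a site.** [folklore] -/
theorem wgt_eq_zero_of_near (hk : k ≤ S.P.m + S.P.K) (hR : CollarOK S 𝔠 k) {js : ℕ} (hjs : js < k) {c : Site S.P 0}
    (hc : c ∈ Omega 𝔠.lane.carrier.M₁ (rcolOf S 𝔠.lane.carrier) k h js) {y : Site S.P 0} (hy : Site.tdist c y ≤ 2)
    (hy' : k ≤ js + 1 ∨ y ∉ Omega 𝔠.lane.carrier.M₁ (rcolOf S 𝔠.lane.carrier) k h (js + 1)) {j : ℕ} (hj1 : j ≠ js) (hj2 : j ≠ js + 1) :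
    wgt S 𝔠 h j y = 0 := by
  unfold wgt
  rcases Nat.lt_or_gt_of_ne hj1 with hlt | hgt
  · rw [Theta_eq_one_of_near S 𝔠 h hk hR hjs hc hy hlt.le, Theta_eq_one_of_near S 𝔠 h hk hR hjs hc hy (by omega)]; ring
  · rw [Theta_eq_zero_of_near S 𝔠 h hk hR hy' (by omega), Theta_eq_zero_of_near S 𝔠 h hk hR hy' (by omega)]; ring

/-- The active weights in terms of `θ_{j⋆+1}`. [folklore] -/
theorem wgt_active_eq (hk : k ≤ S.P.m + S.P.K) (hR : CollarOK S 𝔠 k) {js : ℕ} (hjs : js < k) {c : Site S.P 0}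
    (hc : c ∈ Omega 𝔠.lane.carrier.M₁ (rcolOf S 𝔠.lane.carrier) k h js) {y : Site S.P 0} (hy : Site.tdist c y ≤ 2)
    (hy' : k ≤ js + 1 ∨ y ∉ Omega 𝔠.lane.carrier.M₁ (rcolOf S 𝔠.lane.carrier) k h (js + 1)) :
    wgt S 𝔠 h js y = 1 - Theta 𝔠.lane.carrier.M₁ (rcolOf S 𝔠.lane.carrier) R0 h (js + 1) y ∧
    wgt S 𝔠 h (js + 1) y = Theta 𝔠.lane.carrier.M₁ (rcolOf S 𝔠.lane.carrier) R0 h (js + 1) y := by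
  unfold wgt
  rw [Theta_eq_one_of_near S 𝔠 h hk hR hjs hc hy le_rfl, Theta_eq_zero_of_near S 𝔠 h hk hR hy' le_rfl]
  exact ⟨rfl, sub_zero _⟩

end Weights

/-! ## §2 The curl bound of the blended potential and the closed regular class -/

section Regular

variable {X : Matrix (Fin 𝔊.N) (Fin 𝔊.N) ℂ} {k : ℕ} (h : Hist S.P k)

/-- **★ THE CURL BOUND**: at a torus plaquette `(y; μ,ν)`, `μ ≠ ν`, with a corner in `Ω_{j⋆}(h)` and no corner in `Ω_{j⋆+1}(h)` (or `k ≤ j⋆ + 1`):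
`|curl potZ (lab y; μ,ν)| ≤ 2·amp j⋆` (`k ≤ K`, collars `≥ 14`). [folklore] -/
theorem abs_curl_potZ_le (hX0 : X ≠ 0) (hk : k ≤ S.K) (hR : CollarOK S 𝔠 k) (y : Site S.P 0) {μ ν : Fin S.P.d} (hμν : μ ≠ ν) {js : ℕ} (hjs : js < k)
    {c : Site S.P 0} (hc : c ∈ Omega 𝔠.lane.carrier.M₁ (rcolOf S 𝔠.lane.carrier) k h js)
    (hcor : c = y ∨ c = y.shift μ ∨ c = y.shift ν ∨ c = (y.shift μ).shift ν)
    (hno : k ≤ js + 1 ∨ (y ∉ Omega 𝔠.lane.carrier.M₁ (rcolOf S 𝔠.lane.carrier) k h (js + 1) ∧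
      y.shift μ ∉ Omega 𝔠.lane.carrier.M₁ (rcolOf S 𝔠.lane.carrier) k h (js + 1) ∧
      y.shift ν ∉ Omega 𝔠.lane.carrier.M₁ (rcolOf S 𝔠.lane.carrier) k h (js + 1))) :
    |curl (potZ S 𝔠 X h) (labZ y) μ ν| ≤ 2 * amp S 𝔠 X js := by
  have hkm : k ≤ S.P.m + S.P.K := le_trans hk (Nat.le_add_left _ _)
  have hLodd : Odd L := S.hL.1
  have hL1 : 1 ≤ L := le_of_lt S.hL.2
  have hLr : (1 : ℝ) ≤ L := by exact_mod_cast hL1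
  have hR1 : 1 ≤ R0 := by norm_num [R0]
  -- distances between the corners
  have hd1 : Site.tdist y (y.shift μ) ≤ 1 := tdist_shift_le y μ
  have hd2 : Site.tdist y (y.shift ν) ≤ 1 := tdist_shift_le y ν
  have hd3 : Site.tdist (y.shift μ) ((y.shift μ).shift ν) ≤ 1 := tdist_shift_le _ ν
  have hd4 : Site.tdist (y.shift ν) ((y.shift μ).shift ν) ≤ 1 := by rw [shift_comm y hμν]; exact tdist_shift_le _ μ
  have hdμν : Site.tdist (y.shift μ) (y.shift ν) ≤ 2 :=
    (tdist_triangle _ y _).trans (add_le_add (by rw [tdist_comm]; exact hd1) hd2)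
  -- the three points `y, y+e_μ, y+e_ν` are within distance 2 of the corner `c`
  have hn0 : Site.tdist c y ≤ 2 := by
    rcases hcor with h' | h' | h' | h' <;> rw [h']
    · rw [tdist_self']; omega
    · rw [tdist_comm]; omega
    · rw [tdist_comm]; omega
    · calc Site.tdist ((y.shift μ).shift ν) y ≤ Site.tdist ((y.shift μ).shift ν) (y.shift μ) + Site.tdist (y.shift μ) y := tdist_triangle _ _ _
        _ ≤ 1 + 1 := add_le_add (by rw [tdist_comm]; exact hd3) (by rw [tdist_comm]; exact hd1)
  have hnμ : Site.tdist c (y.shift μ) ≤ 2 := by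
    rcases hcor with h' | h' | h' | h' <;> rw [h']
    · omega
    · rw [tdist_self']; omega
    · rw [tdist_comm]; exact hdμν
    · rw [tdist_comm]; omega
  have hnν : Site.tdist c (y.shift ν) ≤ 2 := by
    rcases hcor with h' | h' | h' | h' <;> rw [h']
    · omega
    · exact hdμν
    · rw [tdist_self']; omega
    · rw [tdist_comm]; omega
  have hno0 : k ≤ js + 1 ∨ y ∉ Omega 𝔠.lane.carrier.M₁ (rcolOf S 𝔠.lane.carrier) k h (js + 1) := by
    rcases hno with hk' | ⟨h1, -, -⟩; exacts [Or.inl hk', Or.inr h1]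
  have hnoμ : k ≤ js + 1 ∨ y.shift μ ∉ Omega 𝔠.lane.carrier.M₁ (rcolOf S 𝔠.lane.carrier) k h (js + 1) := by
    rcases hno with hk' | ⟨-, h2, -⟩; exacts [Or.inl hk', Or.inr h2]
  have hnoν : k ≤ js + 1 ∨ y.shift ν ∉ Omega 𝔠.lane.carrier.M₁ (rcolOf S 𝔠.lane.carrier) k h (js + 1) := by
    rcases hno with hk' | ⟨-, -, h3⟩; exacts [Or.inl hk', Or.inr h3]
  -- the three points as projections of the labels
  have hp0 : projSite (labZ y) = y := projSite_labZ y
  have hpμ : projSite (labZ y + e μ) = y.shift μ := by rw [projSite_add_e, projSite_labZ]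
  have hpν : projSite (labZ y + e ν) = y.shift ν := by rw [projSite_add_e, projSite_labZ]
  -- apply the two-level bound
  set M : ℕ := L ^ js with hM
  have hM1 : (1 : ℝ) ≤ (M : ℝ) := by exact_mod_cast Nat.one_le_pow _ _ hL1
  have hamp0 : 0 ≤ amp S 𝔠 X js := amp_nonneg S 𝔠 hX0 (by omega)
  have hamp1 : 0 ≤ amp S 𝔠 X (js + 1) := amp_nonneg S 𝔠 hX0 (by omega)
  have hampL : amp S 𝔠 X (js + 1) ≤ amp S 𝔠 X js / L := amp_succ_le S 𝔠 hX0 (by omega)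
  have key := abs_curl_blend_le (k := k) (projSite (P := S.P)) (wgt S 𝔠 h) (fun j => patPot (L ^ j) (amp S 𝔠 X j)) (labZ y) μ ν js
    (c := amp S 𝔠 X js) (δ := 1 / ((R0 * S.P.L ^ js : ℕ) : ℝ))
    (m := fun j => |amp S 𝔠 X j| * 2 * (((L : ℝ) ^ j + 1) / 2))
    hamp0 (by positivity) (fun j => by positivity) ?_ ?_ ?_ ?_ ?_ ?_
  · refine key.trans ?_
    -- arithmetic: `amp + 2δ(m js + m (js+1)) ≤ 2 amp`
    have hPL : S.P.L = L := rfl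
    rw [hPL, abs_of_nonneg hamp0, abs_of_nonneg hamp1]
    have hRM : ((R0 * L ^ js : ℕ) : ℝ) = 8 * (M : ℝ) := by rw [hM]; norm_num [R0]
    rw [hRM]
    have hM0 : (0 : ℝ) < M := by linarith
    have hL0 : (0 : ℝ) < L := by linarith
    have hLM : ((L : ℝ) ^ (js + 1) : ℝ) = L * M := by rw [hM, pow_succ]; push_cast; ring
    rw [show ((L : ℝ) ^ js) = (M : ℝ) by rw [hM]; push_cast; rfl, hLM]
    -- bound `amp (js+1)·(LM+1) ≤ (amp js / L)(LM + 1) ≤ amp js (M + 1)`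
    have h1 : amp S 𝔠 X (js + 1) * ((L : ℝ) * M + 1) ≤ amp S 𝔠 X js * ((M : ℝ) + 1) := by
      calc amp S 𝔠 X (js + 1) * ((L : ℝ) * M + 1) ≤ (amp S 𝔠 X js / L) * ((L : ℝ) * M + 1) :=
            mul_le_mul_of_nonneg_right hampL (by positivity)
        _ = amp S 𝔠 X js * ((M : ℝ) + 1 / L) := by field_simp
        _ ≤ amp S 𝔠 X js * ((M : ℝ) + 1) := by
            refine mul_le_mul_of_nonneg_left ?_ hamp0
            have : 1 / (L : ℝ) ≤ 1 := by rw [div_le_one hL0]; exact hLr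
            linarith
    have h2 : ((M : ℝ) + 1) / M ≤ 2 := by rw [div_le_iff₀ hM0]; linarith
    calc amp S 𝔠 X js + 2 * (1 / (8 * (M : ℝ))) *
          (amp S 𝔠 X js * 2 * (((M : ℝ) + 1) / 2) + amp S 𝔠 X (js + 1) * 2 * (((L : ℝ) * M + 1) / 2))
        = amp S 𝔠 X js + (1 / (4 * (M : ℝ))) * (amp S 𝔠 X js * ((M : ℝ) + 1) + amp S 𝔠 X (js + 1) * ((L : ℝ) * M + 1)) := by
          ring
      _ ≤ amp S 𝔠 X js + (1 / (4 * (M : ℝ))) * (amp S 𝔠 X js * ((M : ℝ) + 1) + amp S 𝔠 X js * ((M : ℝ) + 1)) := by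
          gcongr
      _ = amp S 𝔠 X js + amp S 𝔠 X js * (((M : ℝ) + 1) / M) / 2 := by field_simp; ring
      _ ≤ amp S 𝔠 X js + amp S 𝔠 X js * 2 / 2 := by gcongr
      _ = 2 * amp S 𝔠 X js := by ring
  · -- h0: other weights vanish at the three points
    intro j hj hj1 hj2
    refine ⟨?_, ?_, ?_⟩
    · rw [hp0]; exact wgt_eq_zero_of_near S 𝔠 h hkm hR hjs hc hn0 hno0 hj1 hj2
    · rw [hpμ]; exact wgt_eq_zero_of_near S 𝔠 h hkm hR hjs hc hnμ hnoμ hj1 hj2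
    · rw [hpν]; exact wgt_eq_zero_of_near S 𝔠 h hkm hR hjs hc hnν hnoν hj1 hj2
  · intro j; exact wgt_nonneg S 𝔠 h hkm hR j _
  · exact sum_wgt_le_one S 𝔠 h k _
  · -- hδ: the active weights are `1/(8 L^{js})`-Lipschitz between the points
    intro j hj
    have hW : ∀ y', Site.tdist y y' ≤ 1 →
        |Theta 𝔠.lane.carrier.M₁ (rcolOf S 𝔠.lane.carrier) R0 h (js + 1) y' - Theta 𝔠.lane.carrier.M₁ (rcolOf S 𝔠.lane.carrier) R0 h (js + 1) y| ≤
          1 / ((R0 * S.P.L ^ js : ℕ) : ℝ) := by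
      intro y' hy'
      have hlip := abs_Theta_sub_le 𝔠.lane.carrier.M₁ (rcolOf S 𝔠.lane.carrier) R0 h hR1 (show 1 ≤ js + 1 by omega) y' y
      rw [Nat.add_sub_cancel] at hlip
      refine hlip.trans (div_le_div_of_nonneg_right ?_ (by positivity))
      rw [tdist_comm]; exact_mod_cast hy'
    obtain ⟨a0, b0⟩ := wgt_active_eq S 𝔠 h hkm hR hjs hc hn0 hno0
    obtain ⟨aμ, bμ⟩ := wgt_active_eq S 𝔠 h hkm hR hjs hc hnμ hnoμ
    obtain ⟨aν, bν⟩ := wgt_active_eq S 𝔠 h hkm hR hjs hc hnν hnoν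
    rw [hp0, hpμ, hpν]
    rcases hj with hj | hj <;> rw [hj]
    · rw [a0, aμ, aν]
      constructor
      · rw [show (1 - Theta _ _ R0 h (js + 1) (y.shift μ)) - (1 - Theta _ _ R0 h (js + 1) y) =
          -(Theta 𝔠.lane.carrier.M₁ (rcolOf S 𝔠.lane.carrier) R0 h (js + 1) (y.shift μ) - Theta _ _ R0 h (js + 1) y) by ring, abs_neg]
        exact hW _ hd1
      · rw [show (1 - Theta _ _ R0 h (js + 1) (y.shift ν)) - (1 - Theta _ _ R0 h (js + 1) y) =
          -(Theta 𝔠.lane.carrier.M₁ (rcolOf S 𝔠.lane.carrier) R0 h (js + 1) (y.shift ν) - Theta _ _ R0 h (js + 1) y) by ring, abs_neg]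
        exact hW _ hd2
    · rw [b0, bμ, bν]
      exact ⟨hW _ hd1, hW _ hd2⟩
  · -- hc: `|curl patPot| ≤ amp ≤ amp js`
    intro j hj
    refine (abs_curl_patPot_le (L ^ j) (hLodd.pow) _ _ μ ν).trans ?_
    rcases hj with rfl | rfl
    · rw [abs_of_nonneg hamp0]
    · rw [abs_of_nonneg hamp1]
      exact hampL.trans (div_le_self hamp0 hLr)
  · -- hm: `|patPot| ≤ |amp|(d−1)(M+1)/2`, `d = 3`
    intro j _
    have hd3 : ((S.P.d : ℕ) : ℝ) - 1 = 2 := by norm_num [show S.P.d = 3 from rfl]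
    have h1 := abs_patPot_le (L ^ j) (hLodd.pow) (amp S 𝔠 X j) (labZ y + e μ) ν
    have h2 := abs_patPot_le (L ^ j) (hLodd.pow) (amp S 𝔠 X j) (labZ y + e ν) μ
    rw [hd3] at h1 h2
    push_cast at h1 h2
    exact ⟨h1, h2⟩

/-- **★ THE PROFILE LIES IN [7]'S CLOSED REGULAR CLASS** `regClassC 𝔊 𝔠 k h` (`k ≤ K`, collars `Rcol j ≥ 14` for `j + 1 ≤ k`).
[cite: Balaban1985Variational, (2)+(8) pp.278–279; Balaban1985UV3, (68) p.273] -/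
theorem prof_mem_regClassC (hX : X ∈ 𝔊.lie) (hX0 : X ≠ 0) (hk : k ≤ S.K) (hR : CollarOK S 𝔠 k) : prof S 𝔠 h hX ∈ regClassC 𝔊 𝔠 k h := by
  classical
  have hkm : k ≤ S.P.m + S.P.K := le_trans hk (Nat.le_add_left _ _)
  intro j hj y μ ν hμν hcor
  set P : ℕ → Prop := fun j => y ∈ Omega 𝔠.lane.carrier.M₁ (rcolOf S 𝔠.lane.carrier) k h j ∨
    y.shift μ ∈ Omega 𝔠.lane.carrier.M₁ (rcolOf S 𝔠.lane.carrier) k h j ∨ y.shift ν ∈ Omega 𝔠.lane.carrier.M₁ (rcolOf S 𝔠.lane.carrier) k h j ∨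
    (y.shift μ).shift ν ∈ Omega 𝔠.lane.carrier.M₁ (rcolOf S 𝔠.lane.carrier) k h j with hPdef
  set js : ℕ := Nat.findGreatest P (k - 1) with hjs_def
  have hjle : j ≤ js := Nat.le_findGreatest (by omega) hcor
  have hjsk : js < k := lt_of_le_of_lt (Nat.findGreatest_le (k - 1)) (by omega)
  have hspec := Nat.findGreatest_eq_iff.1 hjs_def.symm
  have hPjs : P js := by
    by_cases hz : js = 0
    · rw [hz]; exact Or.inl (by rw [BalabanUVNodesN08AlphaB7Scale1.Omega_level_zero]; trivial)
    · exact hspec.2.1 hz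
  have hno : k ≤ js + 1 ∨ (y ∉ Omega 𝔠.lane.carrier.M₁ (rcolOf S 𝔠.lane.carrier) k h (js + 1) ∧
      y.shift μ ∉ Omega 𝔠.lane.carrier.M₁ (rcolOf S 𝔠.lane.carrier) k h (js + 1) ∧
      y.shift ν ∉ Omega 𝔠.lane.carrier.M₁ (rcolOf S 𝔠.lane.carrier) k h (js + 1)) := by
    by_cases hk1 : k ≤ js + 1
    · exact Or.inl hk1
    · right
      have hnot : ¬ P (js + 1) := hspec.2.2 (Nat.lt_succ_self js) (by omega)
      simp only [hPdef, not_or] at hnot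
      exact ⟨hnot.1, hnot.2.1, hnot.2.2.1⟩
  have hbound : |curl (potZ S 𝔠 X h) (labZ y) μ ν| ≤ 2 * amp S 𝔠 X js := by
    rcases hPjs with hc | hc | hc | hc
    · exact abs_curl_potZ_le S 𝔠 h hX0 hk hR y hμν hjsk hc (Or.inl rfl) hno
    · exact abs_curl_potZ_le S 𝔠 h hX0 hk hR y hμν hjsk hc (Or.inr (Or.inl rfl)) hno
    · exact abs_curl_potZ_le S 𝔠 h hX0 hk hR y hμν hjsk hc (Or.inr (Or.inr (Or.inl rfl))) hno
    · exact abs_curl_potZ_le S 𝔠 h hX0 hk hR y hμν hjsk hc (Or.inr (Or.inr (Or.inr rfl))) hno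
  calc dist1 (plaqVar (prof S 𝔠 h hX) y μ ν) ≤ |curl (potZ S 𝔠 X h) (labZ y) μ ν| * ‖X‖ := dist1_plaqVar_prof_le S 𝔠 h hX hkm y μ ν
    _ ≤ 2 * amp S 𝔠 X js * ‖X‖ := mul_le_mul_of_nonneg_right hbound (norm_nonneg X)
    _ ≤ 2 * amp S 𝔠 X j * ‖X‖ := by
        have := amp_antitone S 𝔠 hX0 hjle (by omega)
        have hXn : 0 ≤ ‖X‖ := norm_nonneg X
        nlinarith
    _ = 𝔠.C68 / 2 * (S.gk j * pFun 𝔠.lane.carrier.b₀ 𝔠.lane.carrier.p₀ (S.gk j)) * (((L : ℝ) ^ j)⁻¹) ^ 2 := two_mul_amp_mul_norm S 𝔠 hX0 j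

end Regular

end Summit.QuantumFields.YangMills.Theorems.BalabanUVNodesN08AlphaProfileRegular

end
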